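import Literature.MathematicalPhysics.QuantumFieldTheory.Balaban1983to89.B9Thm311ContinuityMethodRegularZd
import Literature.MathematicalPhysics.QuantumFieldTheory.Balaban1983to89.B9Eq336GaugeOrbitConnectedZd

/-!
# `Balaban1983to89.B9Thm311GBoundCompactZd` — [Balaban1985BackgroundPropagators] (3.115) p. 418 ∕ Thm 3.11 p. 416 ∕ (3.27) p. 395 AT THE `ℤᵈ × 𝔸` CARRIER:
# ONE BOUND ON `|G_𝔤(U₀)|` OVER A COMPACT CLASS OF REGULAR BACKGROUNDS, the displayed input of `B9Thm311ContinuityMethodRegularZd` INHABITED on a small ball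
# at every cube member (A6), the `𝒩_δ` family, and the unconditional `∃ α` ∕ `∃ aI` corollaries along the REGULARITY road

statement-level skeleton of published theorems with citation tags; proofs where landed; nothing here is a claim about the
Yang–Mills mass gap

`[Balaban1985BackgroundPropagators]` ("B9", CMP **99** (1985) 389–434) p. 418 (3.115) (`|G(U)|` bounded uniformly for `U` in (3.35)), p. 416 Thm 3.11, p. 395
(3.27), p. 396 (3.36); [4] = [Balaban1984PropagatorsII] p. 226 «bounded from below by a positive constant».  PDF held:
`paper:balaban1985-cmp99-background-propagators` pp. 395–396, 416–418.

CITATION HEADER ∕ WHY THIS FILE (cell `pub-ymgap`, HUMAN RULING D-0062 ∕ D-0149; width seat `pub-ymgap-dag-n06-w3` (g4), node N06 = [B9]; CLAIM-5; count-neutral).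
The companion `B9Thm311ContinuityMethodRegularZd` (CLAIM-4) displays a uniform bound `c⟨A, A⟩_τ ≤ ⟨□₀Δ_a(U₀)A, □₀Δ_a(U₀)A⟩_τ` at the regular points of a
family.  THIS FILE (§1) produces such a bound over any COMPACT class of regular backgrounds — dag-n06-w4 g4's engine `B9Eq335UnitaryClassCompactZd.
exists_coercive_of_isCompact` applied to the RESIDUAL forms — and (§2) at every cube member inhabits the companion's hypothesis on a uniform ball below the
window (dag-n06-w4 g4's coercive closed ball `B9Thm311CoerciveCompactZd.exists_coercive_closedBall_one_cube` ⟹ regular there; its compactness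
`isCompact_unitary_closedBall`), whence UNCONDITIONALLY `∃ α > 0` with `G_𝔤(U₀)` on print's local class — dag-n06-b g20's `regularAtH_of_plaqTouches_cube` re-derived along the regularity road
(a cross-check, not a new fact; the `∃ aI` form IS their `invAtHI_withGopZdH_opsAllZd_cube` and is not restated) — and the `𝒩_δ` version of the companion's §4 over
this seat's `B9Eq336GaugeOrbitConnectedZd`.

WHAT IS PROVED (kernel, 0 sorry; theorems only — no `def`, `instance`, `notation`).
* §1 ★★ `exists_gbound_on_of_isCompact` — `K ⊆ 𝒰` compact, `Δ_a` ℝ-linear on `𝒰`, letters continuous within `𝒰` at `K` on `E_𝔤(Ω₀)`, every point of `K`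
  regular ⟹ ONE `c > 0` with `c⟨A, A⟩_τ ≤ ⟨Ω₀Δ_a(U₀)A, Ω₀Δ_a(U₀)A⟩_τ` on `K` (constant NON-explicit).
* §2 (cube members, class `cubeLamBP`, `m ≤ k`, `2 ≤ d`, `2 ≤ L ≤ ρ`; faithful Hermitian tracial `τ`) ★★ `exists_window_gbound` (A6 of the companion:
  `∃ δ > 0` below the window, `∃ c > 0`, the bound on the whole `δ`-ball) · ★★ `exists_alpha_regularAtH_of_plaqTouches` ·
  ★★★ `regularAtH_on_orbitBall_of_gbound` (`G_𝔤` on all of `𝒩_δ` from the bound at its regular points).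

HONEST SCOPE.  Compactness × finite dimension + by-name composition: the constants of §2 are EXISTENTIAL and member-dependent (no uniform `α₀′`, `M₀`, no
(3.115) with print's constants — that is N06's object-bound, Sects. B–E); `regularAtH_on_orbitBall_of_gbound` is CONDITIONAL on the displayed bound; no
estimate of [B9]; count-neutral helper; N05 ∕ N06 NOT discharged; K1⁸ `stmt-QuantumFields-26907` NOT closed; one finite `𝕋⁴` programme at fixed `ε`,
Bałaban as printed; R4 closes only the conditional finite-`𝕋⁴` rung `BalabanLadder.UV` — nothing continuum ∕ ℝ⁴ ∕ OS ∕ mass gap ∕ Clay.  Unit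
`pub-ymgap-dag-n06-w3` (g4), 2026-08-28.
-/

noncomputable section

namespace Literature.MathematicalPhysics.QuantumFieldTheory.Balaban1983to89.B9Thm311GBoundCompactZd

open scoped Topology
open Filter
open B7Prop1Explicit
open B7Prop2Explicit (unitaryUnits unitaryUnits_le_U1)
open B8Ineq132 (BondTouches plaqF PlaqTouches InAk)
open B9SupplySockB9P3ZdLetters (OpsZd deltaAOf)
open B9SupplySockB9P3ZdLettersOmega (restrictDom restrictDom_of restrictDom_of_not)
open B9Eq316AveragingTransposeZd (tauForm tauForm_apply Reg17 alphaQ alphaQ_pos)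
open B9Eq327GreenZd (domSub bondPair deltaADom LinearOnDomAt setOf_bondTouches_finite restrictDom_mem_domSub)
open B9Eq327GreenZdHerm (domSubH domSubH_le mem_domSubH_iff HermPreservingAt RegularAtH finiteDimensional_domSubH regularAtH_of_bondPair_pos)
open B9Thm311PosDefOpenZd (LettersContinuousWithinAt eq_zero_of_not_mem_bondFinset cubeMember_Ω0_finite)
open B9Thm311FlatHermKernelZd (bondPair_eq_sum_of_vanish_off)
open B9Eq335UnitaryClassCompactZd (exists_coercive_of_isCompact isCompact_unitary_closedBall)
open B9Thm311CoerciveCompactZd (exists_coercive_closedBall_one_cube)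
open B9Thm311ContinuityMethodRegularZd (residual_pos_of_regularAtH continuous_tauForm₂ regularAtH_on_of_isPreconnected regularAtH_one_cube
  regularAtH_of_plaqTouches_of_gbound)
open B9SupplySockB9P3ZdAllLettersZd (opsAllZd)
open B9Eq17RegimeBallZd (ball_subset_reg17UnivP)
open B9Thm311PosDefOpenRegimeZd (lettersContinuousWithinAt_opsAllZd_cube_reg17UnivP)
open B9Eq326DeltaAHermitianZdCurved (linear_herm_on_reg17UnivP)
open B9Thm311SmallFieldPathZdContinuity (delta_le_two_of_window)
open B9Eq336GaugeOrbitConnectedZd (one_mem_orbitBall orbitBall_subset_reg17UnivP isPreconnected_orbitBall moduleFinite_complex)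
open B8Eq131Cubes (sqLo sqHi)
open B8Eq131CubesAdmissible (cubeFam)
open B8CubeMemberZd (cubeLamS)
open B8Ineq159FlatCubeMemberPrinted (cubeLamBP)
open B8LeafModelZd (ZdIdx)

-- `Site` alone could resolve to the torus sites of `Setup.lean`; re-export the `ℤ^d` sites of `B7Prop1Explicit`.
export B7Prop1Explicit (Site)

variable {d : ℕ} {𝔸 : Type*} [CStarAlgebra 𝔸] [FiniteDimensional ℝ 𝔸] (τ : 𝔸 →ₗ[ℂ] ℂ)

/-! ## §1  ONE bound on `|G|` over a COMPACT class of regular backgrounds (the compactness reading of (3.115)) -/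

section Carrier

/-- ★★ **A UNIFORM BOUND ON `‖G_𝔤(U₀)‖_τ` OVER A COMPACT CLASS OF REGULAR BACKGROUNDS** (finite `Ω₀`, finite-dimensional fibre, faithful `τ`).  Let `K ⊆ 𝒰` be
COMPACT; suppose `Δ_a(U₀)` is ℝ-linear on `E(Ω₀)` for `U₀ ∈ 𝒰`, its letters are continuous within `𝒰` at every point of `K` on `E_𝔤(Ω₀)`, and `Δ_a(U₀)↾Ω₀`
is invertible on `E_𝔤(Ω₀)` at every `U₀ ∈ K`.  Then ONE `c > 0` gives `c·⟨A, A⟩_τ ≤ ⟨Ω₀Δ_a(U₀)A, Ω₀Δ_a(U₀)A⟩_τ` for ALL `U₀ ∈ K`, all Hermitian `A ∈ E(Ω₀)`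
— `‖G_𝔤(U₀)‖_τ ≤ c^{−1∕2}` uniformly on `K` (dag-n06-w4 g4's `exists_coercive_of_isCompact` on the RESIDUAL forms; print's (3.115) read by compactness, the
constant NON-explicit). [cite: Balaban1985BackgroundPropagators, (3.115) p.418, Thm 3.11 p.416, (3.27) p.395] -/
theorem exists_gbound_on_of_isCompact (hτp : ∀ a : 𝔸, a ≠ 0 → 0 < (τ (star a * a)).re) {η : ℝ} {o : OpsZd d 𝔸} {Ω₀ : Set (Site d)}
    (hΩ : Ω₀.Finite) {𝒰 K : Set (Site d → Fin d → 𝔸ˣ)} (hK𝒰 : K ⊆ 𝒰) (hK : IsCompact K)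
    (hlin : ∀ U₀ ∈ 𝒰, LinearOnDomAt η o Ω₀ U₀) (hcont : ∀ U₁ ∈ K, LettersContinuousWithinAt η o Ω₀ (domSubH Ω₀) 𝒰 U₁)
    (hreg : ∀ U₀ ∈ K, RegularAtH η o Ω₀ U₀) :
    ∃ c : ℝ, 0 < c ∧ ∀ U₀ ∈ K, ∀ A ∈ domSubH (𝔸 := 𝔸) Ω₀,
      c * bondPair τ A A ≤ bondPair τ (deltaADom η o Ω₀ U₀ A) (deltaADom η o Ω₀ U₀ A) := by
  classical
  haveI : FiniteDimensional ℝ (domSubH (𝔸 := 𝔸) Ω₀) := finiteDimensional_domSubH hΩ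
  let W : Submodule ℝ (Site d → Fin d → 𝔸) := domSubH Ω₀
  have hW : W ≤ domSub (𝔸 := 𝔸) Ω₀ := domSubH_le Ω₀
  choose! T hT using hlin
  let S : Finset (Site d × Fin d) := (setOf_bondTouches_finite (d := d) hΩ).toFinset
  have hSb : ∀ b ∈ S, BondTouches Ω₀ b.1 b.2 := fun b hb => (setOf_bondTouches_finite (d := d) hΩ).mem_toFinset.1 hb
  have hS : ∀ A ∈ W, ∀ b : Site d × Fin d, b ∉ S → A b.1 b.2 = 0 :=
    fun A hA b hb => eq_zero_of_not_mem_bondFinset hΩ (hW hA) b hb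
  have hvan : ∀ (U : Site d → Fin d → 𝔸ˣ) (A : Site d → Fin d → 𝔸), ∀ b : Site d × Fin d, b ∉ S → deltaADom η o Ω₀ U A b.1 b.2 = 0 :=
    fun U A b hb => eq_zero_of_not_mem_bondFinset hΩ (restrictDom_mem_domSub Ω₀ _) b hb
  -- evaluation at a bond, as a linear map
  let ev : Site d × Fin d → ((Site d → Fin d → 𝔸) →ₗ[ℝ] 𝔸) := fun b =>
    (LinearMap.proj (R := ℝ) (φ := fun _ : Fin d => 𝔸) b.2).comp (LinearMap.proj (R := ℝ) (φ := fun _ : Site d => Fin d → 𝔸) b.1)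
  -- residual forms `q U (A, B) = Σ_{b ∈ S} Re τ((T U A)(b)* (T U B)(b))`, norm form `N (A, B) = Σ_{b ∈ S} Re τ(A(b)* B(b))`
  let q : (Site d → Fin d → 𝔸ˣ) → W →ₗ[ℝ] W →ₗ[ℝ] ℝ := fun U =>
    ∑ b ∈ S, (tauForm τ).compl₁₂ ((ev b).comp ((T U).comp W.subtype)) ((ev b).comp ((T U).comp W.subtype))
  let N : W →ₗ[ℝ] W →ₗ[ℝ] ℝ := ∑ b ∈ S, (tauForm τ).compl₁₂ ((ev b).comp W.subtype) ((ev b).comp W.subtype)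
  have hq : ∀ U (A B : W), q U A B = ∑ b ∈ S, tauForm τ (T U A b.1 b.2) (T U B b.1 b.2) := by
    intro U A B
    simp only [q, LinearMap.sum_apply, LinearMap.compl₁₂_apply, LinearMap.comp_apply, Submodule.subtype_apply, ev,
      LinearMap.proj_apply]
  have hN : ∀ A B : W, N A B = ∑ b ∈ S, tauForm τ ((A : Site d → Fin d → 𝔸) b.1 b.2) ((B : Site d → Fin d → 𝔸) b.1 b.2) := by
    intro A B
    simp only [N, LinearMap.sum_apply, LinearMap.compl₁₂_apply, LinearMap.comp_apply, Submodule.subtype_apply, ev,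
      LinearMap.proj_apply]
  have hTS : ∀ U ∈ 𝒰, ∀ A : W, ∀ b ∈ S, T U A b.1 b.2 = deltaADom η o Ω₀ U A b.1 b.2 := by
    intro U hU A b hb
    rw [hT U hU A (hW A.2), deltaADom, restrictDom_of _ (hSb b hb)]
  have hqU : ∀ U ∈ 𝒰, ∀ A B : W, q U A B = ∑ b ∈ S, tauForm τ (deltaADom η o Ω₀ U A b.1 b.2) (deltaADom η o Ω₀ U B b.1 b.2) := by
    intro U hU A B
    rw [hq]
    exact Finset.sum_congr rfl fun b hb => by rw [hTS U hU A b hb, hTS U hU B b hb]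
  have hdiag : ∀ U ∈ 𝒰, ∀ A : W, q U A A = bondPair τ (deltaADom η o Ω₀ U A) (deltaADom η o Ω₀ U A) := by
    intro U hU A
    rw [hqU U hU, bondPair_eq_sum_of_vanish_off τ S (hvan U A)]
  have hNA : ∀ A : W, N A A = bondPair τ (A : Site d → Fin d → 𝔸) A := by
    intro A
    rw [hN, bondPair_eq_sum_of_vanish_off τ S (hS A A.2)]
  -- the entries are continuous on `K`
  have hcq : ∀ A B : W, ContinuousOn (fun U => q U A B) K := by
    intro A B U₁ hU₁
    have hA : ∀ b ∈ S, ContinuousWithinAt (fun U => deltaADom η o Ω₀ U A b.1 b.2) 𝒰 U₁ := fun b hb => by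
      have h := hcont U₁ hU₁ A A.2 b.1 b.2 (hSb b hb)
      refine h.congr (fun U _ => ?_) ?_ <;> exact restrictDom_of _ (hSb b hb)
    have hB : ∀ b ∈ S, ContinuousWithinAt (fun U => deltaADom η o Ω₀ U B b.1 b.2) 𝒰 U₁ := fun b hb => by
      have h := hcont U₁ hU₁ B B.2 b.1 b.2 (hSb b hb)
      refine h.congr (fun U _ => ?_) ?_ <;> exact restrictDom_of _ (hSb b hb)
    have h : ContinuousWithinAt
        (fun U => ∑ b ∈ S, tauForm τ (deltaADom η o Ω₀ U A b.1 b.2) (deltaADom η o Ω₀ U B b.1 b.2)) 𝒰 U₁ :=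
      tendsto_finsetSum S fun b hb => ((continuous_tauForm₂ τ).tendsto _).comp ((hA b hb).prodMk_nhds (hB b hb))
    exact (h.mono hK𝒰).congr (fun U hU => hqU U (hK𝒰 hU) A B) (hqU U₁ (hK𝒰 hU₁) A B)
  -- positivity of the residual forms on `K` (regular points)
  have hposq : ∀ U ∈ K, ∀ A : W, A ≠ 0 → 0 < q U A A := by
    intro U hU A hA
    rw [hdiag U (hK𝒰 hU) A]
    exact residual_pos_of_regularAtH τ hτp hΩ (hreg U hU) A A.2 fun h => hA (Subtype.ext h)
  obtain ⟨c, hc, hcoer⟩ := exists_coercive_of_isCompact q N hK hcq hposq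
  refine ⟨c, hc, fun U hU A hA => ?_⟩
  have h := hcoer U hU ⟨A, hA⟩
  rwa [hdiag U (hK𝒰 hU), hNA] at h

end Carrier

/-! ## §2  Cube members: the bound on `|G|` is INHABITED on a small ball (A6 of `B9Thm311ContinuityMethodRegularZd`), and the unconditional corollaries -/

section Cube

variable [Nontrivial 𝔸] {L : ℕ}
  (hτp : ∀ a : 𝔸, a ≠ 0 → 0 < (τ (star a * a)).re) (hτt : ∀ a b : 𝔸, τ (a * b) = τ (b * a))
  (hτs : ∀ a : 𝔸, τ (star a) = starRingEnd ℂ (τ a))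

include hτp hτt hτs in
/-- ★★ **A6 ∕ NON-VACUITY OF THE DISPLAYED BOUND ON `|G|` AT SOME RADIUS**: at every cube member (class `cubeLamBP`, `m ≤ k`, `2 ≤ d`, `2 ≤ L ≤ ρ`) there are
`δ > 0` with `4δ < (α_Q∕L²)L^{−2m}` and `c > 0` such that `c·⟨A, A⟩_τ ≤ ⟨□₀Δ_a(U₀)A, □₀Δ_a(U₀)A⟩_τ` on `E_𝔤(□₀)` for EVERY `U₀` of the uniform `δ`-ball (all of
whose points are regular) — dag-n06-w4 g4's coercive closed ball (`exists_coercive_closedBall_one_cube`: positivity ⟹ regularity on it), its compactness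
(`isCompact_unitary_closedBall`), and §1. [cite: Balaban1985BackgroundPropagators, (3.115) p.418, Thm 3.11 p.416, (3.27) p.395, (3.36) p.396] -/
theorem exists_window_gbound (hd2 : 2 ≤ d) (hL2 : 2 ≤ L) (ops₀ : ℝ → ZdIdx d L → ℕ → OpsZd d 𝔸) (M : ℝ) (i : ZdIdx d L)
    {a : Site d} {Mc ρ : ℕ} (hρ : L ≤ ρ) (hΩ : i.Ω = cubeFam false L a Mc ρ i.k) (hΛs : i.Λs = cubeLamS L a Mc ρ i.k) {m : ℕ} (hm : m ≤ i.k) :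
    ∃ δ : ℝ, 0 < δ ∧ 4 * δ < alphaQ d L / (L : ℝ) ^ 2 * (((L : ℝ) ^ m)⁻¹) ^ 2 ∧ ∃ c : ℝ, 0 < c ∧
      ∀ U₀ ∈ {U : Site d → Fin d → 𝔸ˣ | (∀ x κ, U x κ ∈ unitaryUnits 𝔸) ∧ ∀ x κ, ‖((U x κ : 𝔸ˣ) : 𝔸) - 1‖ < δ},
        RegularAtH i.η (opsAllZd τ L (cubeLamBP L a Mc ρ i.k) ops₀ M i m) (i.Ω 0) U₀ →
          ∀ A ∈ domSubH (𝔸 := 𝔸) (i.Ω 0), c * bondPair τ A A ≤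
            bondPair τ (deltaADom i.η (opsAllZd τ L (cubeLamBP L a Mc ρ i.k) ops₀ M i m) (i.Ω 0) U₀ A)
              (deltaADom i.η (opsAllZd τ L (cubeLamBP L a Mc ρ i.k) ops₀ M i m) (i.Ω 0) U₀ A) := by
  haveI : NeZero L := ⟨by omega⟩
  have hL1 : 1 ≤ L := le_trans (by norm_num) hL2
  have hfin := cubeMember_Ω0_finite i hΩ
  have hstr := linear_herm_on_reg17UnivP τ hτt hτs hτp hL2 (cubeLamBP L a Mc ρ i.k) ops₀ M i m hfin
  obtain ⟨δ₁, hδ₁, c₁, hc₁, hcoer⟩ := exists_coercive_closedBall_one_cube τ hτp hτt hτs hd2 hL2 ops₀ M i hρ hΩ hΛs hm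
  have hw : 0 < alphaQ d L / (L : ℝ) ^ 2 * (((L : ℝ) ^ m)⁻¹) ^ 2 := by
    have := alphaQ_pos d hL1
    have hL0 : (0 : ℝ) < L := by exact_mod_cast (lt_of_lt_of_le zero_lt_one hL1)
    positivity
  -- the radius: inside the coercive ball and below the window
  set δ : ℝ := min δ₁ (alphaQ d L / (L : ℝ) ^ 2 * (((L : ℝ) ^ m)⁻¹) ^ 2 / 10) with hδdef
  have hδ0 : 0 < δ := lt_min hδ₁ (by positivity)
  have hδw : 4 * δ < alphaQ d L / (L : ℝ) ^ 2 * (((L : ℝ) ^ m)⁻¹) ^ 2 := by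
    have h8 := min_le_right δ₁ (alphaQ d L / (L : ℝ) ^ 2 * (((L : ℝ) ^ m)⁻¹) ^ 2 / 10)
    linarith
  -- the CLOSED δ-ball: compact, inside the regime, every point regular
  have hKc := isCompact_unitary_closedBall (d := d) (𝔸 := 𝔸) δ
  have hKU : {U : Site d → Fin d → 𝔸ˣ | (∀ x κ, U x κ ∈ unitaryUnits 𝔸) ∧ ∀ x κ, ‖((U x κ : 𝔸ˣ) : 𝔸) - 1‖ ≤ δ} ⊆
      {U₀ : Site d → Fin d → 𝔸ˣ | (∀ x κ, U₀ x κ ∈ unitaryUnits 𝔸) ∧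
        Reg17 L m (fun _ => (Set.univ : Set (Site d))) (alphaQ d L / (L : ℝ) ^ 2) U₀} := by
    have hδ2 : 4 * (2 * δ) < alphaQ d L / (L : ℝ) ^ 2 * (((L : ℝ) ^ m)⁻¹) ^ 2 := by
      have h8 := min_le_right δ₁ (alphaQ d L / (L : ℝ) ^ 2 * (((L : ℝ) ^ m)⁻¹) ^ 2 / 10)
      linarith
    intro U hU
    exact ball_subset_reg17UnivP hL1 m hδ2 ⟨hU.1, fun x κ => (hU.2 x κ).trans_lt (by linarith)⟩
  have hregK : ∀ U₀ ∈ {U : Site d → Fin d → 𝔸ˣ | (∀ x κ, U x κ ∈ unitaryUnits 𝔸) ∧ ∀ x κ, ‖((U x κ : 𝔸ˣ) : 𝔸) - 1‖ ≤ δ},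
      RegularAtH i.η (opsAllZd τ L (cubeLamBP L a Mc ρ i.k) ops₀ M i m) (i.Ω 0) U₀ := by
    intro U₀ hU
    have hpos : ∀ A ∈ domSubH (𝔸 := 𝔸) (i.Ω 0), A ≠ 0 →
        0 < bondPair τ A (deltaAOf i.η (opsAllZd τ L (cubeLamBP L a Mc ρ i.k) ops₀ M i m) U₀ A) := by
      intro A hA hA0
      have h := hcoer U₀ hU.1 (fun x κ => (hU.2 x κ).trans (min_le_left _ _)) A hA
      have hAA := B9Eq327GreenZd.bondPair_self_pos τ hτp
        (fun μ => B9Eq327GreenZd.support_finite_of_mem_domSub hfin (domSubH_le (i.Ω 0) hA) μ) hA0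
      nlinarith
    exact regularAtH_of_bondPair_pos τ hfin (hstr.1 U₀ (hKU hU)) (hstr.2 U₀ (hKU hU)) hpos
  obtain ⟨c, hc, hb⟩ := exists_gbound_on_of_isCompact τ hτp hfin hKU hKc (fun U₀ hU => hstr.1 U₀ hU)
    (fun U₁ hU₁ => lettersContinuousWithinAt_opsAllZd_cube_reg17UnivP τ hτp hτt hτs hd2 hL2 (cubeLamBP L a Mc ρ i.k) ops₀ M i hΩ hΛs hρ hm (hKU hU₁))
    hregK
  exact ⟨δ, hδ0, hδw, c, hc, fun U₀ hU _ => hb U₀ ⟨hU.1, fun x κ => (hU.2 x κ).le⟩⟩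

include hτp hτt hτs in
/-- ★★ **HENCE, UNCONDITIONALLY, `∃ α > 0` (member-dependent) WITH `G_𝔤(U₀)` ON PRINT'S LOCAL CLASS** via the REGULARITY road
(`B9Thm311ContinuityMethodRegularZd.regularAtH_of_plaqTouches_of_gbound` fed by §2's `δ, c`) — dag-n06-b g20's `regularAtH_of_plaqTouches_cube` re-derived a
second way (cross-check, not a new fact). [cite: Balaban1985BackgroundPropagators, Thm 3.11 p.416, (3.27) p.395; Balaban1985RegularSpaces, (1.7) p.77, Lemma 1 p.79, (1.131) p.99] -/
theorem exists_alpha_regularAtH_of_plaqTouches (hd2 : 2 ≤ d) (hL2 : 2 ≤ L) (ops₀ : ℝ → ZdIdx d L → ℕ → OpsZd d 𝔸) (M : ℝ) (i : ZdIdx d L)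
    {a : Site d} {Mc ρ : ℕ} (hρ : L ≤ ρ) (hΩ : i.Ω = cubeFam false L a Mc ρ i.k) (hΛs : i.Λs = cubeLamS L a Mc ρ i.k) {m : ℕ} (hm : m ≤ i.k) :
    ∃ α : ℝ, 0 < α ∧ ∀ U₀ : Site d → Fin d → 𝔸ˣ, (∀ x κ, U₀ x κ ∈ unitaryUnits 𝔸) →
      (∀ (z : Site d) (κ μ : Fin d), κ ≠ μ → PlaqTouches (i.Ω 0) z κ μ → ‖plaqF U₀ κ μ z - 1‖ ≤ α) →
        RegularAtH i.η (opsAllZd τ L (cubeLamBP L a Mc ρ i.k) ops₀ M i m) (i.Ω 0) U₀ := by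
  obtain ⟨δ, hδ0, hδ, c, hc, hb⟩ := exists_window_gbound τ hτp hτt hτs hd2 hL2 ops₀ M i hρ hΩ hΛs hm
  have hN : (0 : ℝ) < (B7Prop1Explicit.l1 (sqHi L a Mc ρ i.k 0 - sqLo L a ρ i.k 0) : ℝ) + 1 := by positivity
  refine ⟨δ / 2 / ((B7Prop1Explicit.l1 (sqHi L a Mc ρ i.k 0 - sqLo L a ρ i.k 0) : ℝ) + 1), by positivity, fun U₀ hU₀ hsmall => ?_⟩
  refine regularAtH_of_plaqTouches_of_gbound τ hτp hτt hτs hd2 hL2 ops₀ M i hρ hΩ hΛs hm hδ0 hδ hc hb (by positivity) ?_ hU₀ hsmall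
  rw [mul_div_cancel₀ _ hN.ne']
  linarith

include hτp hτt hτs in
/-- ★★★ **`G_𝔤(U₀)` EXISTS ON THE WHOLE `δ`-NEIGHBOURHOOD OF THE PURE-GAUGE ORBIT `𝒩_δ`, FROM THE BOUND ON `|G|`** (the companion's §4 for the family of this
seat's `B9Eq336GaugeOrbitConnectedZd` — ONE preconnected gauge-invariant class inside `𝒰′` containing `1`).
[cite: Balaban1985BackgroundPropagators, Thm 3.11 p.416, (3.115) p.418, (3.27) p.395, (3.36) p.396] -/
theorem regularAtH_on_orbitBall_of_gbound (hd2 : 2 ≤ d) (hL2 : 2 ≤ L) (ops₀ : ℝ → ZdIdx d L → ℕ → OpsZd d 𝔸) (M : ℝ) (i : ZdIdx d L)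
    {a : Site d} {Mc ρ : ℕ} (hΩ : i.Ω = cubeFam false L a Mc ρ i.k) (hΛs : i.Λs = cubeLamS L a Mc ρ i.k) (hρ : L ≤ ρ) {m : ℕ} (hm : m ≤ i.k)
    {δ : ℝ} (hδ0 : 0 < δ) (hδ : 4 * δ < alphaQ d L / (L : ℝ) ^ 2 * (((L : ℝ) ^ m)⁻¹) ^ 2) {c : ℝ} (hc : 0 < c)
    (hbound : ∀ U₀ ∈ {U : Site d → Fin d → 𝔸ˣ | ∃ w : Site d → 𝔸ˣ, (∀ z, w z ∈ unitaryUnits 𝔸) ∧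
        U ∈ (fun V => gaugeAct w V) '' {U : Site d → Fin d → 𝔸ˣ | (∀ x κ, U x κ ∈ unitaryUnits 𝔸) ∧ ∀ x κ, ‖((U x κ : 𝔸ˣ) : 𝔸) - 1‖ < δ}},
      RegularAtH i.η (opsAllZd τ L (cubeLamBP L a Mc ρ i.k) ops₀ M i m) (i.Ω 0) U₀ →
        ∀ A ∈ domSubH (𝔸 := 𝔸) (i.Ω 0), c * bondPair τ A A ≤
          bondPair τ (deltaADom i.η (opsAllZd τ L (cubeLamBP L a Mc ρ i.k) ops₀ M i m) (i.Ω 0) U₀ A)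
            (deltaADom i.η (opsAllZd τ L (cubeLamBP L a Mc ρ i.k) ops₀ M i m) (i.Ω 0) U₀ A)) :
    ∀ U₀ ∈ {U : Site d → Fin d → 𝔸ˣ | ∃ w : Site d → 𝔸ˣ, (∀ z, w z ∈ unitaryUnits 𝔸) ∧
        U ∈ (fun V => gaugeAct w V) '' {U : Site d → Fin d → 𝔸ˣ | (∀ x κ, U x κ ∈ unitaryUnits 𝔸) ∧ ∀ x κ, ‖((U x κ : 𝔸ˣ) : 𝔸) - 1‖ < δ}},
      RegularAtH i.η (opsAllZd τ L (cubeLamBP L a Mc ρ i.k) ops₀ M i m) (i.Ω 0) U₀ := by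
  haveI : NeZero L := ⟨by omega⟩
  haveI : Module.Finite ℂ 𝔸 := moduleFinite_complex
  have hL1 : 1 ≤ L := le_trans (by norm_num) hL2
  have hfin := cubeMember_Ω0_finite i hΩ
  have hS𝒰 := orbitBall_subset_reg17UnivP (d := d) (𝔸 := 𝔸) hL1 m hδ
  have hstr := linear_herm_on_reg17UnivP τ hτt hτs hτp hL2 (cubeLamBP L a Mc ρ i.k) ops₀ M i m hfin
  exact regularAtH_on_of_isPreconnected τ hτp hfin (isPreconnected_orbitBall hδ0 (delta_le_two_of_window hL1 hδ))
    (fun U₀ hU => hstr.1 U₀ (hS𝒰 hU)) (fun U₀ hU => hstr.2 U₀ (hS𝒰 hU))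
    (fun U₁ hU₁ => (lettersContinuousWithinAt_opsAllZd_cube_reg17UnivP τ hτp hτt hτs hd2 hL2 (cubeLamBP L a Mc ρ i.k) ops₀ M i hΩ hΛs hρ hm
      (hS𝒰 hU₁)).mono_set hS𝒰) hc hbound (one_mem_orbitBall hδ0) (regularAtH_one_cube τ hτp hτt hτs hd2 hL2 ops₀ M i hΩ hΛs hm)

end Cube

end Literature.MathematicalPhysics.QuantumFieldTheory.Balaban1983to89.B9Thm311GBoundCompactZd

end
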